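import Summits.BirchSwinnertonDyer.BirchSwinnertonDyer.Theorems.PrintCFramBottomClassIndexLawFiveLeBorelHomothetySah
import Literature.NumberTheory.EllipticCurves.SerreOpenImageDeterminantProofs
import Literature.NumberTheory.EllipticCurves.HeegnerPointsKolyvaginConjugation
import HarnessLib

/-!
# Route `PrintCFram`, crux C2 `BottomClassIndexLawFiveLe` (stmt-BirchSwinnertonDyer-20372), line
# `eisenstein-resource-bdp-line` (v7 stub S2 `stub_kolyvaginUpper_borelCM`): at level `p`, the
# commutator-product `h·c·h·c⁻¹` acts on `E[p]` as the scalar `χ̄_p(h)`; and the two Galois elements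
# `h` (fixing `√−p`, `χ̄_p(h) ≠ 1`) and `c` (negating `√−p`) over a quadratic field `K ∌ √−p`
# (cell `bsd-print-cfram`, seat `bsd-line-cfram-p1-w2` g5; helper `--supports` 20372; 0 facts, 0 defs)

HONEST FRAMING. Nothing about BSD is proved here. File 2/3 (see `…BorelHomothetySah` for 1/3):

* §4 `exists_mem_geomTorsion_apply_ne_zero` — an additive endomorphism `μ` of `E(ℚ̄)` with
  `μ ∘ μ = [m]`, `|m| = p`, is non-zero on `E[p]` (socle argument in `E[p²]`, `#E[n] = n²`);
  **`exists_smul_eq_cyclotomic_smul`** — if moreover `p ∣ m` and `h, c ∈ Γ_ℚ` commute / anti-commute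
  with `μ`, then `h·c·h·c⁻¹` acts on `E[p]` as an integer `d` with `d ≡ χ̄_p(h) (mod p)`: in a frame
  of `E[p]` (`exists_frame_galoisRepTorsion_rat`: `det ρ̄ = χ̄_p` by the Weil pairing, PROVED in the
  tree) `μ` is a non-zero `A` with `A² = 0`, `ρ̄(h) = u + vA`, `ρ̄(c)` conjugates it to `u − vA`, and the
  product is `u² = det ρ̄(h)` (file 1/3 §3). On the CM leaf this says: on `Γ_{K·K''}` the two
  diagonal characters of `ρ̄` COINCIDE and their square is `χ̄_p`.
* §6 over a number field `K` with `[K:ℚ] = 2`: `exists_restrict_smul_eq_neg` — if `−p ∉ K²` some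
  `c ∈ Γ_K` negates `√−p` (Galois descent `InfiniteGalois.mem_range_algebraMap_iff_fixed`);
  `exists_restrict_smul_eq_self_cyclotomic_ne_one` — for `p ≥ 7` some `h ∈ Γ_K` fixes `√−p` with
  `χ̄_p(h) ≠ 1` (index count: `[Γ_K : Stab(√−p)] ≤ 2`, `χ̄_p(Γ_K)` of index `∣ 2` in `𝔽_pˣ` by
  `modPCyclotomicCharacterZMod_rat_surjective` and `index_range_absGaloisRestrict_eq_finrank`,
  `#𝔽_pˣ = p − 1 > 4`).

No surjectivity of `ρ̄`, no Chebotarev, no CM main theorem. THEOREMS ONLY; no definition, no named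
fact, no `sorry`; imports no `Theses` module. BSD is not proved by any of this; no summit statement
is proved by this seat.
References: [GrigorovJorzaPatrikisSteinTarnita2009] Prop. 5.4; [Serre1972] §1.11, §5.2 (iii);
[SilvermanAEC2009] III.8 (Weil pairing).
-/

set_option autoImplicit false
-- `…BirchSwinnertonDyer.BirchSwinnertonDyer.Theorems…` is the problem's mandated namespace (D-0017).
set_option linter.dupNamespace false

noncomputable section

open scoped Classical Matrix

namespace Summit.BirchSwinnertonDyer.BirchSwinnertonDyer.Theorems.PrintCFram.BorelHomothety

open WeierstrassCurve Field Literature.NumberTheory.EllipticCurves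
  Literature.NumberTheory.GaloisRepresentations

universe u

/-! ## §4 Level `p`: the commutator-product `h·c·h·c⁻¹` acts on `E[p]` as the scalar `χ̄_p(h)` -/

section LevelP

variable (W : WeierstrassCurve ℚ) [W.IsElliptic] (p : ℕ) [hp : Fact p.Prime]

/-- **`μ` is non-zero on `E[p]` when `μ ∘ μ = [m]` with `|m| = p`.** Otherwise, for `Q ∈ E[p²]`
not in `E[p]` (it exists: `#E[p²] = p⁴ > p² = #E[p]`), `μ Q ∈ E[p]` (as `p μ Q = μ (pQ) = 0`),
so `m Q = μ(μ Q) = 0` and `Q ∈ E[p]` — a contradiction. [folklore] -/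
theorem exists_mem_geomTorsion_apply_ne_zero {μ : AddMonoid.End W.geomPoints} {m : ℤ}
    (hμμ : ∀ P, μ (μ P) = m • P) (hm : m.natAbs = p) :
    ∃ P ∈ geomTorsion W (p : ℤ), μ P ≠ 0 := by
  by_contra hall
  simp only [not_exists, not_and, ne_eq, not_not] at hall
  have hpr : p.Prime := hp.out
  have hp0 : (p : AlgebraicClosure ℚ) ≠ 0 := Nat.cast_ne_zero.mpr hpr.ne_zero
  have hp20 : ((p ^ 2 : ℕ) : AlgebraicClosure ℚ) ≠ 0 := by
    exact_mod_cast pow_ne_zero 2 hp0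
  have hc1 : Nat.card (geomTorsion W (p : ℤ)) = p ^ 2 :=
    card_torsionPoints_eq_sq_holds W (AlgebraicClosure ℚ) (n := p) hp0
  have hc2 : Nat.card (geomTorsion W ((p ^ 2 : ℕ) : ℤ)) = (p ^ 2) ^ 2 :=
    card_torsionPoints_eq_sq_holds W (AlgebraicClosure ℚ) (n := p ^ 2) hp20
  haveI : Finite (geomTorsion W (p : ℤ)) :=
    finite_torsionPoints_holds W (AlgebraicClosure ℚ) (by exact_mod_cast hpr.ne_zero)
  -- a point of `E[p²]` outside `E[p]`
  have hnot : ¬ geomTorsion W ((p ^ 2 : ℕ) : ℤ) ≤ geomTorsion W (p : ℤ) := by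
    intro hle
    have h := AddSubgroup.card_le_of_le hle
    rw [hc1, hc2] at h
    have h2 : 2 ≤ p := hpr.two_le
    nlinarith [Nat.pow_le_pow_left h2 2]
  obtain ⟨Q, hQ2, hQ1⟩ := SetLike.not_le_iff_exists.mp hnot
  have hQ2' : (p ^ 2) • Q = 0 := AddSubgroup.torsionBy.nsmul_iff.mp hQ2
  have hpQ : p • Q ∈ geomTorsion W (p : ℤ) := by
    rw [AddSubgroup.torsionBy.nsmul_iff, ← mul_nsmul', ← pow_two, hQ2']
  have hμQ : μ Q ∈ geomTorsion W (p : ℤ) := by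
    rw [AddSubgroup.torsionBy.nsmul_iff, ← map_nsmul, hall _ hpQ]
  have hmQ : m • Q = 0 := by rw [← hμμ, hall _ hμQ]
  refine hQ1 (AddSubgroup.torsionBy.nsmul_iff.mpr ?_)
  rw [← hm]
  exact natAbs_nsmul_eq_zero.mpr hmQ

/-- **The central homothety at level `p`.** Let `μ` be an additive endomorphism of `E(ℚ̄)` with
`μ ∘ μ = [m]`, `p ∣ m`, non-zero on `E[p]` (for a CM curve at a ramified `p`: `μ = √−p`), and let
`h, c ∈ Γ_ℚ` with `μ` commuting with `h` and ANTI-commuting with `c`. Then `h·c·h·c⁻¹` acts on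
`E[p]` as the scalar `χ̄_p(h) = det ρ̄_{E,p}(h)`: in a frame of `E[p]`, `μ` is a non-zero matrix
`A` with `A² = 0`, `ρ̄(h) = u + vA` commutes with it (commutant of a non-scalar matrix), `ρ̄(c)`
conjugates `u + vA` to `u − vA`, and `(u + vA)(u − vA) = u² = det ρ̄(h) = χ̄_p(h)` (Weil pairing,
`det_frame_galoisRepTorsion_eq`). No image hypothesis, no Chebotarev.
[cite: GrigorovJorzaPatrikisSteinTarnita2009, Prop. 5.4 (mechanism: a non-trivial homothety)]
[cite: Serre1972, §1.11 (det ρ̄ = χ̄)] -/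
theorem exists_smul_eq_cyclotomic_smul {μ : AddMonoid.End W.geomPoints} {m : ℤ}
    (hpm : (p : ℤ) ∣ m) (hμμ : ∀ P, μ (μ P) = m • P) (hμ0 : ∃ P ∈ geomTorsion W (p : ℤ), μ P ≠ 0)
    {h c : absoluteGaloisGroup ℚ} (hh : ∀ P, μ (h • P) = h • μ P)
    (hc : ∀ P, μ (c • P) = -(c • μ P)) :
    ∃ d : ℤ, (d : ZMod p) = ((modPCyclotomicCharacterZMod ℚ p h : (ZMod p)ˣ) : ZMod p) ∧
      ∀ P : geomTorsion W (p : ℤ), (h * c * h * c⁻¹) • P = d • P := by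
  have hpr : p.Prime := hp.out
  haveI : NeZero p := ⟨hpr.ne_zero⟩
  letI : Module (ZMod p) (geomTorsion W (p : ℤ)) := AddSubgroup.torsionBy.zmodModule
  obtain ⟨e, Φ, he, -, hdet, -, -⟩ := exists_frame_galoisRepTorsion_rat W p
  -- `μ` restricted to `E[p]`
  have hμmem : ∀ P : geomTorsion W (p : ℤ), μ (P : W.geomPoints) ∈ geomTorsion W (p : ℤ) := by
    intro P
    rw [AddSubgroup.torsionBy.nsmul_iff, ← map_nsmul, AddSubgroup.torsionBy.nsmul_iff.mp P.2, map_zero]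
  set μV : geomTorsion W (p : ℤ) →+ geomTorsion W (p : ℤ) :=
    { toFun := fun P => ⟨μ P, hμmem P⟩
      map_zero' := Subtype.ext (by simp)
      map_add' := fun P Q => Subtype.ext (by simp) } with hμV_def
  have hμV : ∀ P : geomTorsion W (p : ℤ), ((μV P : geomTorsion W (p : ℤ)) : W.geomPoints) = μ P :=
    fun P => rfl
  -- its matrix `A` in the frame `e`
  set A : Matrix (Fin 2) (Fin 2) (ZMod p) := LinearMap.toMatrix'
    ((e.toAddMonoidHom.comp (μV.comp e.symm.toAddMonoidHom)).toZModLinearMap p) with hA_def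
  have hA : ∀ x : geomTorsion W (p : ℤ), A *ᵥ e x = e (μV x) := by
    intro x
    rw [hA_def, LinearMap.toMatrix'_mulVec]
    change e (μV (e.symm (e x))) = e (μV x)
    rw [e.symm_apply_apply]
  -- the matrices of Galois elements
  set B : absoluteGaloisGroup ℚ → Matrix (Fin 2) (Fin 2) (ZMod p) :=
    fun σ => ((Φ (galoisRepTorsion W p σ) : GL (Fin 2) (ZMod p)) : Matrix (Fin 2) (Fin 2) (ZMod p))
    with hB_def
  have hB : ∀ (σ : absoluteGaloisGroup ℚ) (x : geomTorsion W (p : ℤ)), e (σ • x) = B σ *ᵥ e x := by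
    intro σ x
    rw [hB_def]
    exact he (galoisRepTorsion W p σ) x
  -- matrix identities are tested on the vectors `e x`
  have hext : ∀ {M N : Matrix (Fin 2) (Fin 2) (ZMod p)},
      (∀ x : geomTorsion W (p : ℤ), M *ᵥ e x = N *ᵥ e x) → M = N := by
    intro M N hMN
    refine Matrix.ext_of_mulVec_single fun i => ?_
    obtain ⟨x, hx⟩ := e.surjective (Pi.single i 1)
    rw [← hx, hMN x]
  have hBA : B h * A = A * B h := hext fun x => by
    calc (B h * A) *ᵥ e x = B h *ᵥ (A *ᵥ e x) := (Matrix.mulVec_mulVec _ _ _).symm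
      _ = e (h • μV x) := by rw [hA, ← hB]
      _ = e (μV (h • x)) := by
        congr 1
        exact Subtype.ext (hh x).symm
      _ = (A * B h) *ᵥ e x := by rw [← Matrix.mulVec_mulVec, ← hB, hA]
  have hCA : B c * A = -(A * B c) := hext fun x => by
    calc (B c * A) *ᵥ e x = B c *ᵥ (A *ᵥ e x) := (Matrix.mulVec_mulVec _ _ _).symm
      _ = e (c • μV x) := by rw [hA, ← hB]
      _ = e (-(μV (c • x))) := by
        congr 1
        refine Subtype.ext ?_
        change c • μ (x : W.geomPoints) = -(μ (c • (x : W.geomPoints)))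
        rw [hc, neg_neg]
      _ = (-(A * B c)) *ᵥ e x := by rw [Matrix.neg_mulVec, ← Matrix.mulVec_mulVec, ← hB, hA, map_neg]
  have hA0 : A ≠ 0 := by
    obtain ⟨P, hP, hμP⟩ := hμ0
    intro hA0
    apply hμP
    have h0 : e (μV ⟨P, hP⟩) = 0 := by rw [← hA, hA0, Matrix.zero_mulVec]
    rw [map_eq_zero_iff e e.injective] at h0
    exact congrArg Subtype.val h0
  have hAA : A * A = 0 := hext fun x => by
    rw [← Matrix.mulVec_mulVec, hA, hA, Matrix.zero_mulVec, ← map_zero e]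
    congr 1
    refine Subtype.ext ?_
    change μ (μ (x : W.geomPoints)) = 0
    obtain ⟨k, hk⟩ := hpm
    rw [hμμ, hk, mul_comm, ← smul_smul, natCast_zsmul, AddSubgroup.torsionBy.nsmul_iff.mp x.2, smul_zero]
  have hCC' : B c * B c⁻¹ = 1 := by
    rw [hB_def]
    change ((Φ (galoisRepTorsion W p c) : GL (Fin 2) (ZMod p)) : Matrix (Fin 2) (Fin 2) (ZMod p)) *
      ((Φ (galoisRepTorsion W p c⁻¹) : GL (Fin 2) (ZMod p)) : Matrix (Fin 2) (Fin 2) (ZMod p)) = 1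
    rw [← Units.val_mul, ← map_mul, ← map_mul, mul_inv_cancel, map_one, map_one, Units.val_one]
  -- the product is the scalar `det B h = χ̄_p(h)`
  have hprod := mul_conj_eq_det_smul_one hA0 hAA hBA hCA hCC'
  have hdetB : (B h).det = ((modPCyclotomicCharacterZMod ℚ p h : (ZMod p)ˣ) : ZMod p) := by
    rw [hB_def, ← Matrix.GeneralLinearGroup.val_det_apply, hdet h]
  set d : ℕ := (((modPCyclotomicCharacterZMod ℚ p h : (ZMod p)ˣ) : ZMod p)).val with hd_def
  have hdcast : (d : ZMod p) = ((modPCyclotomicCharacterZMod ℚ p h : (ZMod p)ˣ) : ZMod p) :=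
    ZMod.natCast_zmod_val _
  refine ⟨(d : ℤ), by rw [Int.cast_natCast, hdcast], fun P => ?_⟩
  apply e.injective
  have hmat : B (h * c * h * c⁻¹) = B h * (B c * B h * B c⁻¹) := by
    rw [hB_def]
    change ((Φ (galoisRepTorsion W p (h * c * h * c⁻¹)) : GL (Fin 2) (ZMod p)) :
        Matrix (Fin 2) (Fin 2) (ZMod p)) = _
    rw [map_mul, map_mul, map_mul, map_mul, map_mul, map_mul, Units.val_mul, Units.val_mul,
      Units.val_mul]
    change B h * B c * B h * B c⁻¹ = B h * (B c * B h * B c⁻¹)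
    simp only [Matrix.mul_assoc]
  rw [hB, hmat, hprod, hdetB, Matrix.smul_mulVec, Matrix.one_mulVec, natCast_zsmul, map_nsmul,
    ← hdcast, Nat.cast_smul_eq_nsmul]

end LevelP

/-! ## §6 The two Galois elements over a quadratic field `K ∌ √−p`: `c` negating `√−p`, and `h`
fixing `√−p` with `χ̄_p(h) ≠ 1` -/

section GaloisElements

variable (p : ℕ) [hp : Fact p.Prime] (K : Type u) [Field K] [NumberField K]

omit hp in
/-- Transport of `s² = −p` along the chosen embedding `ℚ̄ → K̄`. [folklore] -/
theorem absClosureEmbedding_sq {s : AlgebraicClosure ℚ}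
    (hs : s ^ 2 = ((-(p : ℤ) : ℤ) : AlgebraicClosure ℚ)) :
    (absClosureEmbedding ℚ K s) ^ 2 = algebraMap K (AlgebraicClosure K) (-(p : K)) := by
  rw [← map_pow, hs]; simp

omit hp [NumberField K] in
/-- Every `σ ∈ Γ_K` maps `s' = √−p ∈ K̄` to `± s'`. [folklore] -/
theorem smul_eq_or_eq_neg {s' : AlgebraicClosure K}
    (hs' : s' ^ 2 = algebraMap K (AlgebraicClosure K) (-(p : K))) (σ : absoluteGaloisGroup K) :
    σ • s' = s' ∨ σ • s' = -s' := by
  have hsq : (σ • s') ^ 2 = s' ^ 2 := by rw [← smul_pow', hs', smul_algebraMap]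
  have h' : (σ • s' - s') * (σ • s' + s') = 0 := by linear_combination hsq
  rcases mul_eq_zero.mp h' with h0 | h0
  · exact Or.inl (sub_eq_zero.mp h0)
  · exact Or.inr (add_eq_zero_iff_eq_neg.mp h0)

omit hp in
/-- **An element of `Γ_K` negating `√−p`**, when `−p` is not a square in `K`: otherwise every
`σ ∈ Γ_K` fixes `√−p ∈ K̄` (its only other option is `−√−p`), so `√−p ∈ K` by Galois descent
(`InfiniteGalois.mem_range_algebraMap_iff_fixed`). [folklore] -/
theorem exists_restrict_smul_eq_neg (hKp : ∀ y : K, y ^ 2 ≠ -(p : K)) {s : AlgebraicClosure ℚ}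
    (hs : s ^ 2 = ((-(p : ℤ) : ℤ) : AlgebraicClosure ℚ)) :
    ∃ c : absoluteGaloisGroup K, absGaloisRestrict ℚ K c • s = -s := by
  haveI : IsGalois K (AlgebraicClosure K) := {}
  set s' : AlgebraicClosure K := absClosureEmbedding ℚ K s with hs'_def
  have hs' : s' ^ 2 = algebraMap K (AlgebraicClosure K) (-(p : K)) := absClosureEmbedding_sq p K hs
  by_contra hall
  rw [not_exists] at hall
  -- every `σ ∈ Γ_K` fixes `s'`
  have hfix : ∀ σ : absoluteGaloisGroup K, σ • s' = s' := by
    intro σ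
    rcases smul_eq_or_eq_neg p K hs' σ with h0 | h0
    · exact h0
    · exfalso
      refine hall σ ((absClosureEmbedding ℚ K).injective ?_)
      show absClosureEmbedding ℚ K (absGaloisRestrict ℚ K σ • s) = absClosureEmbedding ℚ K (-s)
      rw [absGaloisRestrict_apply_smul, map_neg]
      exact h0
  obtain ⟨y, hy⟩ := (InfiniteGalois.mem_range_algebraMap_iff_fixed s').mpr fun f => hfix f
  refine hKp y ?_
  apply (algebraMap K (AlgebraicClosure K)).injective
  rw [map_pow, hy, hs']

/-- **An element of `Γ_K` fixing `√−p` on which `χ̄_p ≠ 1`**, for `K` quadratic and `p ≥ 7`: the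
stabiliser `S` of `√−p` in `Γ_K` has index `≤ 2`, and `χ̄_p(Γ_K)` has index `≤ [K:ℚ] = 2` in
`𝔽_pˣ` (`χ̄_p : Γ_ℚ ↠ 𝔽_pˣ`, `modPCyclotomicCharacterZMod_rat_surjective`), so `χ̄_p(S)` has at
least `(p − 1)/4 > 1` elements. [folklore] -/
theorem exists_restrict_smul_eq_self_cyclotomic_ne_one (hK2 : Module.finrank ℚ K = 2) (h7 : 7 ≤ p)
    {s : AlgebraicClosure ℚ} (hs : s ^ 2 = ((-(p : ℤ) : ℤ) : AlgebraicClosure ℚ)) :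
    ∃ h : absoluteGaloisGroup K, absGaloisRestrict ℚ K h • s = s ∧
      modPCyclotomicCharacterZMod ℚ p (absGaloisRestrict ℚ K h) ≠ 1 := by
  have hpr : p.Prime := hp.out
  haveI : NeZero p := ⟨hpr.ne_zero⟩
  set s' : AlgebraicClosure K := absClosureEmbedding ℚ K s with hs'_def
  have hs' : s' ^ 2 = algebraMap K (AlgebraicClosure K) (-(p : K)) := absClosureEmbedding_sq p K hs
  -- the stabiliser of `s'` and the character `φ = χ̄_p ∘ res`
  set S : Subgroup (absoluteGaloisGroup K) := MulAction.stabilizer (absoluteGaloisGroup K) s'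
    with hS_def
  set φ : absoluteGaloisGroup K →* (ZMod p)ˣ :=
    (modPCyclotomicCharacterZMod ℚ p).comp (absGaloisRestrict ℚ K).toMonoidHom with hφ_def
  suffices hnot : ¬ S ≤ φ.ker by
    obtain ⟨h, hhS, hhφ⟩ := SetLike.not_le_iff_exists.mp hnot
    refine ⟨h, (absClosureEmbedding ℚ K).injective ?_, fun h1 => hhφ (by rw [MonoidHom.mem_ker]; exact h1)⟩
    show absClosureEmbedding ℚ K (absGaloisRestrict ℚ K h • s) = absClosureEmbedding ℚ K s
    rw [absGaloisRestrict_apply_smul]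
    exact hhS
  intro hle
  -- `[Γ_K : S] ≤ 2`: the orbit of `s'` lies in `{s', -s'}`
  have horbit : MulAction.orbit (absoluteGaloisGroup K) s' ⊆ {s', -s'} := by
    rintro _ ⟨σ, rfl⟩
    rcases smul_eq_or_eq_neg p K hs' σ with h0 | h0
    · exact Or.inl h0
    · exact Or.inr h0
  have hSi : S.index ≤ 2 := by
    rw [hS_def, MulAction.index_stabilizer]
    refine (Set.ncard_le_ncard horbit (Set.toFinite _)).trans ?_
    exact (Set.ncard_insert_le _ _).trans (by rw [Set.ncard_singleton])
  have hSi0 : S.index ≠ 0 := by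
    rw [hS_def, MulAction.index_stabilizer]
    exact ((Set.ncard_pos ((Set.toFinite _).subset horbit)).mpr ⟨s', MulAction.mem_orbit_self s'⟩).ne'
  -- so `#φ(Γ_K) = [Γ_K : ker φ] ≤ 2`
  have hker : φ.ker.index ≤ 2 := by
    have hdvd := Subgroup.index_dvd_of_le hle
    exact (Nat.le_of_dvd (Nat.pos_of_ne_zero hSi0) hdvd).trans hSi
  rw [Subgroup.index_ker] at hker
  -- but `φ(Γ_K) = χ̄_p(res Γ_K)` has index `∣ 2` in `𝔽_pˣ`, of order `p - 1 ≥ 6`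
  have hrange : φ.range = ((absGaloisRestrict ℚ K).toMonoidHom.range).map
      (modPCyclotomicCharacterZMod ℚ p) := MonoidHom.range_comp _ _
  have hidx : φ.range.index ∣ 2 := by
    rw [hrange, ← hK2, ← index_range_absGaloisRestrict_eq_finrank ℚ K]
    exact Subgroup.index_map_dvd _ (modPCyclotomicCharacterZMod_rat_surjective p)
  have hcard : Nat.card φ.range * φ.range.index = p - 1 := by
    rw [Subgroup.card_mul_index, Nat.card_eq_fintype_card, ZMod.card_units]
  have hidx2 : φ.range.index ≤ 2 := Nat.le_of_dvd two_pos hidx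
  have : p - 1 ≤ 2 * 2 := by
    rw [← hcard]
    exact Nat.mul_le_mul hker hidx2
  omega

end GaloisElements

end Summit.BirchSwinnertonDyer.BirchSwinnertonDyer.Theorems.PrintCFram.BorelHomothety

end
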